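import Mathlib.Algebra.Algebra.Pi
import Mathlib.Algebra.BigOperators.Ring.Finset
import Mathlib.Algebra.BigOperators.GroupWithZero.Finset
import Mathlib.Algebra.Module.Equiv.Basic
import Mathlib.LinearAlgebra.FiniteDimensional.Lemmas
import Mathlib.LinearAlgebra.Dimension.Constructions
import Mathlib.Algebra.Ring.Parity
import Literature.Computability.MetaComplexity.NaturalProofs
import HarnessLib

/-!
# Smolensky's natural property against `AC⁰[p]`: the algebra and its largeness

Groundwork for the named fact `Literature.Computability.Learning.cikk_learn_AC0Mod`
(Carmosino–Impagliazzo–Kabanets–Kolokolova 2016, Cor. 5.4: `AC⁰[p]` is learnable in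
quasi-polynomial time), whose printed proof combines CIKK Thm. 5.1 with the Razborov–Smolensky
natural properties (CIKK Thm. 5.3, from Razborov–Rudich 1997). For primes `p > 2` the property
of Thm. 5.3 is (CIKK, §5.2, p. 10:20): "Let `f` be a given `n`-variate Boolean function. Without
loss of generality, assume `n` is odd. Denote by `L` the vector space of all multilinear
polynomials of degree less than `n/2` over `GF(p)`. Let `f̄` be the unique multilinear polynomial
over `GF(p)` that represents `f` on the Boolean cube `{-1,1}ⁿ` (after the linear transformation
mapping the Boolean `0` to `1 mod p`, and the Boolean `1` to `-1 mod p`) … Accept `f` if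
`dim(f̄L + L) ≥ (3/4) · 2ⁿ` (over `GF(p)`)."

This file formalises the underlying linear algebra over an arbitrary field `F` (the consumer
takes `F = ZMod p`), identifying multilinear polynomials with the functions they define on the
cube `{0,1}ⁿ` (every function on the cube is a unique multilinear polynomial; only the function
space is used):

* `Smolensky.CubeFn F n = ({0,1}ⁿ → F)`, the monomials `mono F S = Π_{i ∈ S} xᵢ` and the signed
  monomials `pmMono F S = Π_{i ∈ S} (1 - 2xᵢ)` (the monomials in the `±1` variables), the
  degree filtration `lowDeg F n D = span {mono S : |S| ≤ D}` with `mono S · mono T = mono (S ∪ T)`,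
  `lowDeg D · lowDeg D' ⊆ lowDeg (D + D')`, `span (all monomials) = ⊤`;
* for `n` odd and `2 ≠ 0` in `F`: `ḡ · L + L = ⊤` where `ḡ = pmMono univ = Π (1 - 2xᵢ)` is the
  `±1`-valued parity and `L = lowDeg F n (n/2)` (Smolensky 1987, pp. 79–80: every monomial of
  degree `> n/2` is `ḡ` times one of degree `< n/2` on the cube);
* `Smolensky.space F h = f̄L + L` for a Boolean `h` (`f̄ = pmOf F h = 1 - 2h`), the property
  `Smolensky.property F : CombinatorialProperty` (`dim ≥ (3/4)2ⁿ`, as printed), and its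
  **largeness**: for odd `n`, `2^(2^n) ≤ 2 · |property F n|` (`two_pow_le_two_mul_card_property`),
  i.e. density `≥ 1/2` as asserted in CIKK Thm. 5.3, by the pairing `h ↔ h ⊕ PARITY`: with
  `A = f̄L + L` and `B = f̄ · ((f̄ḡ)L + L) = ḡL + f̄L` one has `A + B ⊇ ḡL + L = ⊤` and
  `A ∩ B ⊇ f̄L`, so `dim A + dim B ≥ 2ⁿ + 2ⁿ⁻¹` and one of `h`, `h ⊕ PARITY` has the property.

Deliberately NOT here: the usefulness half (Smolensky's dimension bound from a low-degree
approximation, file `SmolenskyDimensionBound.lean`), the Razborov–Smolensky approximation of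
`AC⁰[p]` circuits by low-degree polynomials, constructivity (rank computation in `P`), and the
`p = 2` property of Thm. 5.3 (Razborov's rank method).

## References

* M. Carmosino, R. Impagliazzo, V. Kabanets, A. Kolokolova, *Learning algorithms from natural
  proofs*, CCC 2016, LIPIcs 50, Thm. 5.3 and §5.2 [CarmosinoImpagliazzoKabanetsKolokolova2016].
* R. Smolensky, *Algebraic methods in the theory of lower bounds for Boolean circuit
  complexity*, STOC 1987, 77–82 (Lemmas 1–2: approximation; pp. 79–80: completeness and the
  dimension bound) [Smolensky1987].
* A. Razborov, S. Rudich, *Natural proofs*, JCSS 55 (1997), §3 [RazborovRudich1997].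
-/

namespace Literature.Computability.MetaComplexity

open Finset Module

namespace Smolensky

variable {F : Type*} [Field F] {n : ℕ}

/-! ### Functions on the cube, monomials, the degree filtration -/

/-- The `F`-algebra of `F`-valued functions on the Boolean cube `{0,1}ⁿ` (pointwise operations;
Smolensky's algebra `U_Fⁿ`); every such function is a unique multilinear polynomial, and we
identify the two. [cite: Smolensky1987, p. 78 (Basic notation: the algebra U_F^n)] -/
abbrev CubeFn (F : Type*) (n : ℕ) : Type _ := (Fin n → Bool) → F

/-- The multilinear monomial `x_S = Π_{i ∈ S} xᵢ` as a function on the cube (`xᵢ ∈ {0,1}`).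
[cite: Smolensky1987, p. 78 (Basic notation: polynomials in U_F^n)] -/
def mono (F : Type*) [Field F] {n : ℕ} (S : Finset (Fin n)) : CubeFn F n :=
  fun b => ∏ i ∈ S, (if b i then (1 : F) else 0)

/-- `x_S(b) = 1` if `bᵢ = 1` for all `i ∈ S`, and `0` otherwise. [folklore] -/
theorem mono_apply (S : Finset (Fin n)) (b : Fin n → Bool) :
    mono F S b = if ∀ i ∈ S, b i = true then 1 else 0 := by
  unfold mono
  rw [Finset.prod_boole]
  congr 1

/-- On the cube `x_S · x_T = x_{S ∪ T}` (since `xᵢ² = xᵢ`). [folklore] -/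
theorem mono_mul (S T : Finset (Fin n)) : mono F S * mono F T = mono F (S ∪ T) := by
  funext b
  simp only [Pi.mul_apply, mono_apply]
  have hU : (∀ i ∈ S ∪ T, b i = true) ↔ (∀ i ∈ S, b i = true) ∧ ∀ i ∈ T, b i = true :=
    Finset.forall_mem_union
  by_cases hS : ∀ i ∈ S, b i = true <;> by_cases hT : ∀ i ∈ T, b i = true
  · rw [if_pos hS, if_pos hT, if_pos (hU.2 ⟨hS, hT⟩), one_mul]
  · rw [if_neg hT, mul_zero, if_neg fun h => hT (hU.1 h).2]
  · rw [if_neg hS, zero_mul, if_neg fun h => hS (hU.1 h).1]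
  · rw [if_neg hS, zero_mul, if_neg fun h => hS (hU.1 h).1]

/-- The empty monomial is the constant `1`. [folklore] -/
@[simp] theorem mono_empty : mono F (∅ : Finset (Fin n)) = 1 := by
  funext b
  simp [mono]

/-- The degree filtration: `lowDeg F n D` is the span of the monomials `x_S` with `|S| ≤ D`, i.e.
the space of (functions on the cube of) multilinear polynomials of degree at most `D`
(Smolensky's `deg_A`; CIKK's `L` is `lowDeg F n (n/2)` for odd `n`).
[cite: CarmosinoImpagliazzoKabanetsKolokolova2016, §5.2 (the space L)] -/
def lowDeg (F : Type*) [Field F] (n D : ℕ) : Submodule F (CubeFn F n) :=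
  Submodule.span F (Set.range fun S : {S : Finset (Fin n) // S.card ≤ D} => mono F S.1)

/-- Unfolding lemma for `lowDeg`. [folklore] -/
theorem lowDeg_eq_span (D : ℕ) :
    lowDeg F n D =
      Submodule.span F (Set.range fun S : {S : Finset (Fin n) // S.card ≤ D} => mono F S.1) :=
  rfl

/-- A monomial of degree `≤ D` lies in `lowDeg D`. [folklore] -/
theorem mono_mem_lowDeg {S : Finset (Fin n)} {D : ℕ} (h : S.card ≤ D) :
    mono F S ∈ lowDeg F n D :=
  Submodule.subset_span ⟨⟨S, h⟩, rfl⟩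

/-- The degree filtration is increasing. [folklore] -/
theorem lowDeg_mono {D D' : ℕ} (h : D ≤ D') : lowDeg F n D ≤ lowDeg F n D' := by
  rw [lowDeg_eq_span (D := D), Submodule.span_le]
  rintro _ ⟨⟨S, hS⟩, rfl⟩
  exact mono_mem_lowDeg (F := F) (hS.trans h)

/-- Degrees add under multiplication: `lowDeg D · lowDeg D' ⊆ lowDeg (D + D')`. [folklore] -/
theorem mul_mem_lowDeg_add {D D' : ℕ} {u v : CubeFn F n} (hu : u ∈ lowDeg F n D)
    (hv : v ∈ lowDeg F n D') : u * v ∈ lowDeg F n (D + D') := by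
  have step : ∀ S : Finset (Fin n), S.card ≤ D → ∀ w ∈ lowDeg F n D',
      mono F S * w ∈ lowDeg F n (D + D') := by
    intro S hS w hw
    have hle : (lowDeg F n D').map (LinearMap.mulLeft F (mono F S)) ≤ lowDeg F n (D + D') := by
      rw [lowDeg_eq_span (D := D'), Submodule.map_span_le]
      rintro _ ⟨⟨T, hT⟩, rfl⟩
      dsimp only
      rw [LinearMap.mulLeft_apply, mono_mul]
      exact mono_mem_lowDeg ((Finset.card_union_le S T).trans (Nat.add_le_add hS hT))
    exact hle (Submodule.mem_map_of_mem hw)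
  have hle : (lowDeg F n D).map (LinearMap.mulRight F v) ≤ lowDeg F n (D + D') := by
    rw [lowDeg_eq_span (D := D), Submodule.map_span_le]
    rintro _ ⟨⟨S, hS⟩, rfl⟩
    dsimp only
    rw [LinearMap.mulRight_apply]
    exact step S hS v hv
  exact hle (Submodule.mem_map_of_mem hu)

/-! ### Every function on the cube is a multilinear polynomial -/

/-- The indicator of a point `a` of the cube expands into monomials:
`δ_a = Σ_{T ⊆ {i : aᵢ = 0}} (-1)^{|T|} x_{{i : aᵢ = 1} ∪ T}` (expand `Π_{aᵢ=1} xᵢ · Π_{aᵢ=0} (1 - xᵢ)`).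
[folklore] -/
theorem indicator_eq_sum (a : Fin n → Bool) :
    (fun b : Fin n → Bool => if b = a then (1 : F) else 0) =
      ∑ T ∈ (univ.filter fun i => a i = false).powerset,
        ((-1 : F) ^ T.card) • mono F ((univ.filter fun i => a i = true) ∪ T) := by
  classical
  set A : Finset (Fin n) := univ.filter fun i => a i = true with hA
  set Ac : Finset (Fin n) := univ.filter fun i => a i = false with hAc
  funext b
  simp only [Finset.sum_apply, Pi.smul_apply, smul_eq_mul]
  -- both sides equal `mono A b * Π_{i ∈ Ac} (1 - xᵢ(b))`
  have hR : ∑ T ∈ Ac.powerset, (-1 : F) ^ T.card * mono F (A ∪ T) b =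
      mono F A b * ∏ i ∈ Ac, (1 + -(if b i then (1 : F) else 0)) := by
    rw [Finset.prod_one_add, Finset.mul_sum]
    refine Finset.sum_congr rfl fun T _ => ?_
    rw [Finset.prod_neg, ← mono_mul, Pi.mul_apply]
    simp only [mono]
    ring
  rw [hR]
  by_cases hb : b = a
  · rw [if_pos hb]
    have h1 : mono F A b = 1 := by
      rw [mono_apply, if_pos]
      intro i hi
      rw [hb]
      simpa [hA] using hi
    have h2 : ∏ i ∈ Ac, (1 + -(if b i then (1 : F) else 0)) = 1 := by
      refine Finset.prod_eq_one fun i hi => ?_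
      have : a i = false := by simpa [hAc] using hi
      simp [hb, this]
    rw [h1, h2, mul_one]
  · rw [if_neg hb]
    obtain ⟨i, hi⟩ : ∃ i, b i ≠ a i := Function.ne_iff.1 hb
    cases ha : a i
    · -- `i ∈ Ac` and `b i = true`: the factor `1 - xᵢ` vanishes
      have hbi : b i = true := by simpa [ha] using hi
      have hmem : i ∈ Ac := by simp [hAc, ha]
      rw [Finset.prod_eq_zero hmem (by simp [hbi]), mul_zero]
    · -- `i ∈ A` and `b i = false`: the monomial vanishes
      have hbi : b i = false := by simpa [ha] using hi
      have hmem : i ∈ A := by simp [hA, ha]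
      have h0 : mono F A b = 0 := by
        rw [mono_apply, if_neg]
        intro h
        simpa [hbi] using h i hmem
      rw [h0, zero_mul]

/-- **Every function on the cube is a multilinear polynomial**: the monomials span `CubeFn F n`.
[folklore] -/
theorem span_range_mono_eq_top :
    Submodule.span F (Set.range (mono F (n := n))) = ⊤ := by
  classical
  refine Submodule.eq_top_iff'.2 fun f => ?_
  have hf : f = ∑ a, f a • (fun b : Fin n → Bool => if b = a then (1 : F) else 0) := by
    funext b
    simp [Finset.sum_apply]
  rw [hf]
  refine Submodule.sum_mem _ fun a _ => Submodule.smul_mem _ _ ?_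
  rw [indicator_eq_sum a]
  exact Submodule.sum_mem _ fun T _ => Submodule.smul_mem _ _ (Submodule.subset_span ⟨_, rfl⟩)

/-! ### Signed (`±1`) monomials and the parity `ḡ` -/

/-- The sign `1 - 2bᵢ ∈ {±1}` of the `i`-th bit (CIKK: "mapping the Boolean `0` to `1` and the
Boolean `1` to `-1`"). [cite: CarmosinoImpagliazzoKabanetsKolokolova2016, §5.2] -/
def sgn (F : Type*) [Field F] {n : ℕ} (b : Fin n → Bool) (i : Fin n) : F := if b i then -1 else 1

/-- The signed monomial `Π_{i ∈ S} (1 - 2xᵢ)` (a monomial in the `±1` variables `yᵢ = 1 - 2xᵢ`);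
`pmMono univ` is the `±1`-valued PARITY `ḡ`.
[cite: Smolensky1987, pp. 79–80 (the variables yᵢ and the character Π yᵢ)] -/
def pmMono (F : Type*) [Field F] {n : ℕ} (S : Finset (Fin n)) : CubeFn F n :=
  fun b => ∏ i ∈ S, sgn F b i

/-- Signs square to one. [folklore] -/
theorem sgn_mul_self (b : Fin n → Bool) (i : Fin n) : sgn F b i * sgn F b i = 1 := by
  unfold sgn
  split <;> simp

/-- Signed monomials square to one (`(±1)² = 1`). [folklore] -/
theorem pmMono_mul_self (S : Finset (Fin n)) : pmMono F S * pmMono F S = 1 := by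
  funext b
  simp only [pmMono, Pi.mul_apply, Pi.one_apply, ← Finset.prod_mul_distrib, sgn_mul_self,
    Finset.prod_const_one]

/-- `pmMono S · pmMono Sᶜ = ḡ`. [folklore] -/
theorem pmMono_mul_compl (S : Finset (Fin n)) :
    pmMono F S * pmMono F Sᶜ = pmMono F univ := by
  funext b
  exact Finset.prod_mul_prod_compl S _

/-- On the cube a signed monomial of degree `|S|` is `ḡ` times the complementary one of degree
`n - |S|`: `ḡ · pmMono Sᶜ = pmMono S` (Smolensky: "it is enough to show that for any monomial of
the form `Π_{i ∈ w} yᵢ` …"). [cite: Smolensky1987, pp. 79–80 (completeness of Π yᵢ)] -/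
theorem pmMono_univ_mul_compl (S : Finset (Fin n)) :
    pmMono F univ * pmMono F Sᶜ = pmMono F S := by
  rw [← pmMono_mul_compl S, mul_assoc, pmMono_mul_self, mul_one]

/-- Expansion of a signed monomial into monomials: `Π_{i∈S} (1 - 2xᵢ) = Σ_{U ⊆ S} (-2)^{|U|} x_U`.
[folklore] -/
theorem pmMono_eq_sum (S : Finset (Fin n)) :
    pmMono F S = ∑ U ∈ S.powerset, ((-2 : F) ^ U.card) • mono F U := by
  funext b
  simp only [pmMono, Finset.sum_apply, Pi.smul_apply, smul_eq_mul, mono]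
  have h : ∀ i ∈ S, sgn F b i = 1 + (-2) * (if b i then (1 : F) else 0) := fun i _ => by
    unfold sgn
    split <;> norm_num
  rw [Finset.prod_congr rfl h, Finset.prod_one_add]
  refine Finset.sum_congr rfl fun U _ => ?_
  rw [Finset.prod_mul_distrib, Finset.prod_const]

/-- A signed monomial of degree `≤ D` lies in `lowDeg D`. [folklore] -/
theorem pmMono_mem_lowDeg {S : Finset (Fin n)} {D : ℕ} (h : S.card ≤ D) :
    pmMono F S ∈ lowDeg F n D := by
  rw [pmMono_eq_sum]
  refine Submodule.sum_mem _ fun U hU => Submodule.smul_mem _ _ (mono_mem_lowDeg ?_)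
  exact (Finset.card_le_card (Finset.mem_powerset.1 hU)).trans h

/-- Expansion of a monomial into signed monomials: `2^{|S|} x_S = Σ_{U ⊆ S} (-1)^{|U|} pmMono U`
(from `2xᵢ = 1 - (1 - 2xᵢ)`). [folklore] -/
theorem two_pow_smul_mono_eq_sum (S : Finset (Fin n)) :
    (2 : F) ^ S.card • mono F S = ∑ U ∈ S.powerset, ((-1 : F) ^ U.card) • pmMono F U := by
  funext b
  simp only [Pi.smul_apply, smul_eq_mul, Finset.sum_apply, mono, pmMono]
  have h2 : ∀ i ∈ S, (2 : F) * (if b i then (1 : F) else 0) = 1 + -sgn F b i := fun i _ => by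
    unfold sgn
    split <;> norm_num
  calc (2 : F) ^ S.card * ∏ i ∈ S, (if b i then (1 : F) else 0)
      = ∏ i ∈ S, (2 * (if b i then (1 : F) else 0)) := by
        rw [Finset.prod_mul_distrib, Finset.prod_const]
    _ = ∏ i ∈ S, (1 + -sgn F b i) := Finset.prod_congr rfl h2
    _ = ∑ U ∈ S.powerset, ∏ i ∈ U, -sgn F b i := Finset.prod_one_add S
    _ = ∑ U ∈ S.powerset, (-1 : F) ^ U.card * ∏ i ∈ U, sgn F b i :=
        Finset.sum_congr rfl fun U _ => by rw [Finset.prod_neg]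

/-- **`ḡL + L` is everything** (Smolensky 1987, §4; the heart of the method): for `n` odd and
`2 ≠ 0` in `F`, with `L = lowDeg F n (n/2)` (degree `< n/2`) and `ḡ = pmMono univ` the `±1`
parity, `ḡ · L + L = ⊤` — every monomial is a combination of signed monomials, each of which has
degree `< n/2` or is `ḡ` times one of degree `< n/2`.
[cite: Smolensky1987, pp. 79–80 (completeness of Π yᵢ: U_F^n = ḡ·L + L)] -/
theorem map_mulLeft_parity_sup_eq_top (hn : Odd n) (h2 : (2 : F) ≠ 0) :
    (lowDeg F n (n / 2)).map (LinearMap.mulLeft F (pmMono F univ)) ⊔ lowDeg F n (n / 2) = ⊤ := by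
  refine top_le_iff.1 ?_
  rw [← span_range_mono_eq_top, Submodule.span_le]
  rintro _ ⟨T, rfl⟩
  have hT : mono F T = ((2 : F) ^ T.card)⁻¹ • ((2 : F) ^ T.card • mono F T) := by
    rw [smul_smul, inv_mul_cancel₀ (pow_ne_zero _ h2), one_smul]
  rw [SetLike.mem_coe, hT, two_pow_smul_mono_eq_sum]
  refine Submodule.smul_mem _ _ (Submodule.sum_mem _ fun U _ => Submodule.smul_mem _ _ ?_)
  by_cases hU : U.card ≤ n / 2
  · exact Submodule.mem_sup_right (pmMono_mem_lowDeg hU)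
  · refine Submodule.mem_sup_left ?_
    rw [← pmMono_univ_mul_compl U]
    refine Submodule.mem_map_of_mem (f := LinearMap.mulLeft F (pmMono F univ)) ?_
    refine pmMono_mem_lowDeg ?_
    rw [Finset.card_compl, Fintype.card_fin]
    obtain ⟨m, rfl⟩ := hn
    omega

/-! ### Smolensky's space `f̄L + L`, the property, and its largeness -/

/-- The `±1` version `f̄ = 1 - 2h` of a Boolean function `h` (`0 ↦ 1`, `1 ↦ -1`), as a function on
the cube. [cite: CarmosinoImpagliazzoKabanetsKolokolova2016, §5.2] -/
def pmOf (F : Type*) [Field F] {n : ℕ} (h : (Fin n → Bool) → Bool) : CubeFn F n :=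
  fun b => if h b then -1 else 1

/-- `f̄² = 1`. [folklore] -/
theorem pmOf_mul_self (h : (Fin n → Bool) → Bool) : pmOf F h * pmOf F h = 1 := by
  funext b
  simp only [pmOf, Pi.mul_apply, Pi.one_apply]
  split <;> simp

/-- **Smolensky's space** `f̄L + L` of a Boolean function `h`, with `L = lowDeg F n (n/2)` the
polynomials of degree `< n/2` (for odd `n`) and `f̄ = pmOf F h`.
[cite: CarmosinoImpagliazzoKabanetsKolokolova2016, Thm. 5.3 (§5.2)] -/
def space (F : Type*) [Field F] {n : ℕ} (h : (Fin n → Bool) → Bool) : Submodule F (CubeFn F n) :=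
  (lowDeg F n (n / 2)).map (LinearMap.mulLeft F (pmOf F h)) ⊔ lowDeg F n (n / 2)

/-- **Smolensky's natural property** (CIKK Thm. 5.3, case `p > 2`, as printed: "Accept `f` if
`dim(f̄L + L) ≥ (3/4) · 2ⁿ`"), over the field `F` (`F = GF(p)` in the source), stated in `ℕ` as
`3 · 2ⁿ ≤ 4 · dim`. [cite: CarmosinoImpagliazzoKabanetsKolokolova2016, Thm. 5.3 (§5.2)] -/
def property (F : Type*) [Field F] : CombinatorialProperty := fun n =>
  {h | 3 * 2 ^ n ≤ 4 * Module.finrank F (space F (n := n) h)}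

/-- Membership in Smolensky's property (definitional). [folklore] -/
theorem mem_property_iff (h : (Fin n → Bool) → Bool) :
    h ∈ property F n ↔ 3 * 2 ^ n ≤ 4 * Module.finrank F (space F h) :=
  Iff.rfl

/-- The dimension of the space of all functions on the cube is `2ⁿ`. [folklore] -/
theorem finrank_cubeFn : Module.finrank F (CubeFn F n) = 2 ^ n := by
  rw [Module.finrank_fintype_fun_eq_card]
  simp

/-- Multiplication by a function `u` with `u² = 1` is a linear automorphism of `CubeFn F n`.
[folklore] -/
def mulEquiv (u : CubeFn F n) (hu : u * u = 1) : CubeFn F n ≃ₗ[F] CubeFn F n :=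
  LinearEquiv.ofInvolutive (LinearMap.mulLeft F u) fun v => by
    simp only [LinearMap.mulLeft_apply, ← mul_assoc, hu, one_mul]

/-- `mulEquiv u` acts as multiplication by `u`. [folklore] -/
@[simp] theorem coe_mulEquiv (u : CubeFn F n) (hu : u * u = 1) :
    (mulEquiv u hu : CubeFn F n →ₗ[F] CubeFn F n) = LinearMap.mulLeft F u :=
  rfl

/-- For odd `n` and `2 ≠ 0`: `dim L ≥ 2ⁿ⁻¹`, in the form `2ⁿ ≤ 2 · dim L` (from `ḡL + L = ⊤` and
`dim ḡL = dim L`). [folklore] -/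
theorem two_pow_le_two_mul_finrank_lowDeg (hn : Odd n) (h2 : (2 : F) ≠ 0) :
    2 ^ n ≤ 2 * Module.finrank F (lowDeg F n (n / 2)) := by
  have htop := map_mulLeft_parity_sup_eq_top (F := F) hn h2
  have hmap : Module.finrank F ((lowDeg F n (n / 2)).map (LinearMap.mulLeft F (pmMono F univ))) =
      Module.finrank F (lowDeg F n (n / 2)) := by
    rw [← coe_mulEquiv _ (pmMono_mul_self univ), LinearEquiv.finrank_map_eq]
  have h := Submodule.finrank_add_le_finrank_add_finrank
    ((lowDeg F n (n / 2)).map (LinearMap.mulLeft F (pmMono F univ))) (lowDeg F n (n / 2))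
  rw [htop, finrank_top, finrank_cubeFn, hmap] at h
  omega

/-- The parity flip `h ⊕ PARITY` of a Boolean function. [folklore] -/
def parityFlip (h : (Fin n → Bool) → Bool) : (Fin n → Bool) → Bool :=
  fun b => xor (h b) (decide (Odd (univ.filter fun i => b i = true).card))

/-- The parity flip is an involution. [folklore] -/
theorem parityFlip_parityFlip (h : (Fin n → Bool) → Bool) : parityFlip (parityFlip h) = h := by
  funext b
  simp [parityFlip]

/-- The `±1` parity: `ḡ(b) = (-1)^{|b|}`. [folklore] -/
theorem pmMono_univ_apply (b : Fin n → Bool) :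
    pmMono F univ b = if Odd (univ.filter fun i => b i = true).card then -1 else 1 := by
  simp only [pmMono, sgn]
  rw [Finset.prod_ite, Finset.prod_const_one, mul_one, Finset.prod_const]
  rcases Nat.even_or_odd (univ.filter fun i => b i = true).card with he | ho
  · rw [he.neg_one_pow, if_neg (Nat.not_odd_iff_even.2 he)]
  · rw [ho.neg_one_pow, if_pos ho]

/-- `(h ⊕ PARITY)‾ = f̄ · ḡ`. [folklore] -/
theorem pmOf_parityFlip (h : (Fin n → Bool) → Bool) :
    pmOf F (parityFlip h) = pmOf F h * pmMono F univ := by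
  funext b
  rw [Pi.mul_apply, pmMono_univ_apply]
  simp only [pmOf, parityFlip]
  by_cases hb : h b = true <;> by_cases ho : Odd (univ.filter fun i => b i = true).card <;>
    simp [hb, ho]

/-- **The pairing inequality**: for odd `n` and `2 ≠ 0` in `F`, every Boolean `h` satisfies
`dim(f̄L + L) + dim((f̄ḡ)L + L) ≥ (3/2) · 2ⁿ`; hence `h` or `h ⊕ PARITY` has Smolensky's property.
Proof: `B := f̄ · ((f̄ḡ)L + L) = ḡL + f̄L` has the same dimension, `A + B ⊇ ḡL + L = ⊤`,
`A ∩ B ⊇ f̄L` with `dim f̄L = dim L ≥ 2ⁿ⁻¹`. [cite: CarmosinoImpagliazzoKabanetsKolokolova2016, Thm. 5.3 (largeness)] -/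
theorem three_mul_two_pow_le (hn : Odd n) (h2 : (2 : F) ≠ 0) (h : (Fin n → Bool) → Bool) :
    3 * 2 ^ n ≤ 2 * (Module.finrank F (space F h) + Module.finrank F (space F (parityFlip h))) := by
  have huu : pmOf F h * pmOf F h = 1 := pmOf_mul_self h
  -- `B := f̄ · space (h ⊕ PARITY) = ḡL + f̄L`
  have hB : (space F (parityFlip h)).map (LinearMap.mulLeft F (pmOf F h)) =
      (lowDeg F n (n / 2)).map (LinearMap.mulLeft F (pmMono F univ)) ⊔
        (lowDeg F n (n / 2)).map (LinearMap.mulLeft F (pmOf F h)) := by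
    rw [space, pmOf_parityFlip, Submodule.map_sup, ← Submodule.map_comp, ← LinearMap.mulLeft_mul,
      ← mul_assoc, huu, one_mul]
  have hdimB : Module.finrank F ((space F (parityFlip h)).map (LinearMap.mulLeft F (pmOf F h))) =
      Module.finrank F (space F (parityFlip h)) := by
    rw [← coe_mulEquiv _ huu, LinearEquiv.finrank_map_eq]
  rw [hB] at hdimB
  -- `A + B = ⊤`
  have hsup : space F h ⊔ ((lowDeg F n (n / 2)).map (LinearMap.mulLeft F (pmMono F univ)) ⊔
      (lowDeg F n (n / 2)).map (LinearMap.mulLeft F (pmOf F h))) = ⊤ := by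
    refine top_le_iff.1 ?_
    rw [← map_mulLeft_parity_sup_eq_top (F := F) hn h2]
    refine sup_le (le_sup_of_le_right le_sup_left) (le_sup_of_le_left ?_)
    unfold space
    exact le_sup_right
  -- `A ∩ B ⊇ f̄L`, and `dim f̄L = dim L`
  have hinf : (lowDeg F n (n / 2)).map (LinearMap.mulLeft F (pmOf F h)) ≤
      space F h ⊓ ((lowDeg F n (n / 2)).map (LinearMap.mulLeft F (pmMono F univ)) ⊔
        (lowDeg F n (n / 2)).map (LinearMap.mulLeft F (pmOf F h))) := by
    refine le_inf ?_ le_sup_right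
    unfold space
    exact le_sup_left
  have hdimuL : Module.finrank F ((lowDeg F n (n / 2)).map (LinearMap.mulLeft F (pmOf F h))) =
      Module.finrank F (lowDeg F n (n / 2)) := by
    rw [← coe_mulEquiv _ huu, LinearEquiv.finrank_map_eq]
  have hkey := Submodule.finrank_sup_add_finrank_inf_eq (space F h)
    ((lowDeg F n (n / 2)).map (LinearMap.mulLeft F (pmMono F univ)) ⊔
      (lowDeg F n (n / 2)).map (LinearMap.mulLeft F (pmOf F h)))
  rw [hsup, finrank_top, finrank_cubeFn, hdimB] at hkey
  have hmono := Submodule.finrank_mono hinf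
  rw [hdimuL] at hmono
  have hLdim := two_pow_le_two_mul_finrank_lowDeg (F := F) hn h2
  omega

/-- **Largeness of Smolensky's property** (CIKK Thm. 5.3: "largeness at least `1/2`"): for odd
`n`, over any field in which `2 ≠ 0` (e.g. `GF(p)`, `p` an odd prime), at least half of all
Boolean functions `h : {0,1}ⁿ → {0,1}` satisfy `dim(f̄L + L) ≥ (3/4)2ⁿ`; in the `ℕ`-form of
`Literature.Computability.Learning.HasDensity`: `2^(2^n) ≤ 2 · |property F n|`.
[cite: CarmosinoImpagliazzoKabanetsKolokolova2016, Thm. 5.3] -/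
theorem two_pow_le_two_mul_card_property (hn : Odd n) (h2 : (2 : F) ≠ 0) :
    2 ^ (2 ^ n) ≤ 2 * Nat.card (property F n) := by
  classical
  set good : Finset ((Fin n → Bool) → Bool) := univ.filter fun h => h ∈ property F n with hgood
  have hcard : Nat.card (property F n) = good.card := by
    rw [Nat.card_eq_fintype_card, ← Set.toFinset_card]
    congr 1
    ext h
    simp [hgood]
  have hcover : (univ : Finset ((Fin n → Bool) → Bool)) ⊆ good ∪ good.image parityFlip := by
    intro h _
    rcases le_or_gt (3 * 2 ^ n) (4 * Module.finrank F (space F h)) with hh | hh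
    · exact Finset.mem_union_left _ (by simp [hgood, mem_property_iff, hh])
    · have hflip : 3 * 2 ^ n ≤ 4 * Module.finrank F (space F (parityFlip h)) := by
        have := three_mul_two_pow_le (F := F) hn h2 h
        omega
      refine Finset.mem_union_right _ (Finset.mem_image.2 ⟨parityFlip h, ?_, ?_⟩)
      · simp [hgood, mem_property_iff, hflip]
      · exact parityFlip_parityFlip h
  have huniv : (univ : Finset ((Fin n → Bool) → Bool)).card = 2 ^ (2 ^ n) := by
    simp
  calc 2 ^ (2 ^ n) = (univ : Finset ((Fin n → Bool) → Bool)).card := huniv.symm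
    _ ≤ (good ∪ good.image parityFlip).card := Finset.card_le_card hcover
    _ ≤ good.card + (good.image parityFlip).card := Finset.card_union_le _ _
    _ ≤ good.card + good.card := Nat.add_le_add_left Finset.card_image_le _
    _ = 2 * Nat.card (property F n) := by rw [hcard]; ring

end Smolensky

end Literature.Computability.MetaComplexity
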